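import Mathlib
import HarnessLib
import Summits.HubbardSuperconductivity.HubbardSuperconductivity.Theorems.KLProgrammeKLRegimeSplitTwoLegSizesMSOfTableF
import Summits.HubbardSuperconductivity.HubbardSuperconductivity.Theorems.KLProgrammePerturbedFermiCurveExplicit

/-!
# Route `KLProgramme`, crux K3 — gen-5 ENGINE child (stmt-…-19918, `stub_twoLeg_step`, clause `TwoLegSizesMST`), recipe (L)+(F):
# (E3a-MS) AT SCALE `n+1` KEYED BY THE ADMISSIBLE PIECES IN THE KL REGIME ((P4-c) step 6 — the chain regime discharged)

Seat hubbard-kl-k3c3-p1 (g3).  The chain regime hypotheses of `twoLegSizesMST_succ_of_chainF_table` (`chainSizeSum … j ≤ A`, `A ≤ 1/20`,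
`klCurveD ≤ Dt_min − 2A`, window margins, `A₃`, `A₄`) are DISCHARGED from the admissible-piece sizes of `FrameOK`
(`a m j = pieceSize R U m j = Gfr_j·uPow_j U·4^{(j−2)m}`) in the KL regime with the CHAIN thresholds `c ≤ klCurveC3 R/16`, `U ≤ klCurveU0 R/16`
(the chain budget is at most `16×` the frame budget: coarse pieces + constants + low parts `3·anchorSize` + high parts `4·anchorSize`):
`A = msA R c U = 16·(2Gfr₀|U| + 2Gfr₁U² + Gfr₂c/log 4)`, `A₃ = msA3 R U N`, `A₄ = msA4 R U N`.  The result
`twoLegSizesMST_succ_of_pieces` is keyed by the stub's binders (pieces `Kp` of `K`, `μ ∈ klWindowC`, `klBetaMin ≤ β ≤ e^{c/U²}`) and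
carries only the engine's exports as hypotheses: the increment symbols at the chain frames (`S`, `σ`), the one-piece responses (`ε`),
continuity of the local parts, the cutoff numeral `X`, and the fits (the high parts enter through their CERTIFIED sizes `msE d (pieceSize R U m)`: contraction or Jackson gain, whichever is smaller).  Proofs only; nothing about the model.
-/

noncomputable section

namespace Summit.HubbardSuperconductivity.HubbardSuperconductivity.Theorems.KLRegimeSplit

set_option linter.dupNamespace false -- summit = problem name (single-conjunct summit), D-0017
set_option maxSynthPendingDepth 4 -- nested operator-norm instances (symbol sizes up to order five), as in `…CompDiff`

open Real Finset Literature.MathematicalPhysics.QuantumLattice Literature.MathematicalPhysics.QuantumLattice.FermiRG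
open Literature.MathematicalPhysics.QuantumLattice.BandSectorCounting
open Summit.HubbardSuperconductivity.HubbardSuperconductivity.Theorems.KLProgrammeLegKernels
open Summit.HubbardSuperconductivity.HubbardSuperconductivity.Theorems.DispersionFlow
open Summit.HubbardSuperconductivity.HubbardSuperconductivity.Theorems.PerturbedFermiCurve

/-! ## §1 The piece sizes and the chain budgets -/

/-- The admissible piece size of `FrameOK`: `Gfr_j · uPow_j U · 4^{(j−2)m}`. -/
def pieceSize (R : RenConsts) (U : ℝ) (m j : ℕ) : ℝ := R.Gfr j * uPow j U * (4 : ℝ) ^ (((j : ℤ) - 2) * m)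

/-- The chain `C²` budget `16·(2Gfr₀|U| + 2Gfr₁U² + Gfr₂·c/log 4)`. -/
def msA (R : RenConsts) (c U : ℝ) : ℝ := 16 * (2 * R.Gfr 0 * |U| + 2 * R.Gfr 1 * U ^ 2 + R.Gfr 2 * (c / Real.log 4))

/-- The chain order-3 budget `16·Gfr₃U²·4^{N+1}/3`. -/
def msA3 (R : RenConsts) (U : ℝ) (N : ℕ) : ℝ := 16 * (R.Gfr 3 * U ^ 2 * ((4 : ℝ) ^ (N + 1) / 3))

/-- The chain order-4 budget `16·Gfr₄U²·16^{N+1}/15`. -/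
def msA4 (R : RenConsts) (U : ℝ) (N : ℕ) : ℝ := 16 * (R.Gfr 4 * U ^ 2 * ((16 : ℝ) ^ (N + 1) / 15))

/-- Piece sizes are nonnegative. -/
theorem pieceSize_nonneg {R : RenConsts} (hR : ∀ j, 0 ≤ R.Gfr j) (U : ℝ) (m j : ℕ) : 0 ≤ pieceSize R U m j := by
  unfold pieceSize; have := hR j; have := uPow_nonneg j U; positivity

/-- **The certified high-part size at order `j`**: the minimum of the contraction form `4·anchorSize a j` and the Jackson gains
available at that order (`j + l ≤ 4`, `…MSPieceParts`); orders `≥ 4` keep the contraction form. -/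
def msE (d : ℕ) (a : ℕ → ℝ) : ℕ → ℝ
  | 0 => min (4 * anchorSize a 0) (min (2 * π ^ 6 / (d + 1) * anchorSize a 1) (min (4 * π ^ 7 / (d + 1) ^ 2 * anchorSize a 2)
      (min (2 * π ^ 13 / (d + 1) ^ 3 * anchorSize a 3) (4 * π ^ 14 / (d + 1) ^ 4 * anchorSize a 4))))
  | 1 => min (4 * anchorSize a 1) (min (2 * π ^ 6 / (d + 1) * anchorSize a 2) (min (4 * π ^ 7 / (d + 1) ^ 2 * anchorSize a 3)
      (2 * π ^ 13 / (d + 1) ^ 3 * anchorSize a 4)))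
  | 2 => min (4 * anchorSize a 2) (min (2 * π ^ 6 / (d + 1) * anchorSize a 3) (4 * π ^ 7 / (d + 1) ^ 2 * anchorSize a 4))
  | 3 => min (4 * anchorSize a 3) (2 * π ^ 6 / (d + 1) * anchorSize a 4)
  | j + 4 => 4 * anchorSize a (j + 4)

/-- **The high parts have the certified sizes `msE`** (`j ≤ 4`). -/
theorem norm_iteratedFDeriv_evalM_highPart_le_msE (d : ℕ) {P : TrigPolyC4v} {a : ℕ → ℝ}
    (ha : ∀ j ≤ 4, ∀ q : Momentum, ‖iteratedFDeriv ℝ j (evalM P) q‖ ≤ a j) {j : ℕ} (hj : j ≤ 4) (q : Momentum) :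
    ‖iteratedFDeriv ℝ j (evalM (highPart d P)) q‖ ≤ msE d a j := by
  obtain ⟨h0, h1, h2, h3, h4⟩ := norm_iteratedFDeriv_evalM_highPart_le d ha
  interval_cases j
  · exact le_min (h0 0 (by norm_num) q) (le_min (h1 0 (by norm_num) q) (le_min (h2 0 (by norm_num) q)
      (le_min (h3 0 (by norm_num) q) (h4 0 (by norm_num) q))))
  · exact le_min (h0 1 (by norm_num) q) (le_min (h1 1 (by norm_num) q) (le_min (h2 1 (by norm_num) q) (h3 1 (by norm_num) q)))
  · exact le_min (h0 2 (by norm_num) q) (le_min (h1 2 (by norm_num) q) (h2 2 (by norm_num) q))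
  · exact le_min (h0 3 (by norm_num) q) (h1 3 (by norm_num) q)
  · exact h0 4 le_rfl q

/-- **The chain size sum is at most sixteen frame sums.** -/
theorem chainSizeSum_le_sixteen_mul {Kp : ℕ → TrigPolyC4v} {a : ℕ → ℕ → ℝ} {n N : ℕ} (hnN : n ≤ N) (hann : ∀ m j, 0 ≤ a m j)
    (ha : ∀ m ≤ N, ∀ j ≤ 4, ∀ q : Momentum, ‖iteratedFDeriv ℝ j (evalM (Kp m)) q‖ ≤ a m j) {j : ℕ} (hj : j ≤ 4) :
    chainSizeSum Kp a n N j ≤ 16 * ∑ m ∈ range (N + 1), a m j := by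
  have hsub1 : range (n + 1) ⊆ range (N + 1) := range_subset_range.mpr (by omega)
  have hsub2 : Ioc n N ⊆ range (N + 1) := fun m hm => by
    have := Finset.mem_Ioc.mp hm; exact mem_range.mpr (by omega)
  have h1 : ∑ m ∈ range (n + 1), a m j ≤ ∑ m ∈ range (N + 1), a m j :=
    Finset.sum_le_sum_of_subset_of_nonneg hsub1 fun m _ _ => hann m j
  have hanchor : ∀ m, anchorSize (a m) j ≤ 2 * a m j := fun m => by
    unfold anchorSize; split_ifs with h
    · subst h; exact le_rfl
    · have := hann m j; linarith
  have h3 : ∑ m ∈ Ioc n N, 3 * anchorSize (a m) j ≤ 6 * ∑ m ∈ range (N + 1), a m j := by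
    calc ∑ m ∈ Ioc n N, 3 * anchorSize (a m) j ≤ ∑ m ∈ Ioc n N, 6 * a m j :=
          Finset.sum_le_sum fun m _ => by have := hanchor m; linarith
      _ ≤ ∑ m ∈ range (N + 1), 6 * a m j :=
          Finset.sum_le_sum_of_subset_of_nonneg hsub2 fun m _ _ => by have := hann m j; positivity
      _ = 6 * ∑ m ∈ range (N + 1), a m j := by rw [Finset.mul_sum]
  have h4 : ∑ m ∈ Ioc n N, 4 * anchorSize (a m) j ≤ 8 * ∑ m ∈ range (N + 1), a m j := by
    calc ∑ m ∈ Ioc n N, 4 * anchorSize (a m) j ≤ ∑ m ∈ Ioc n N, 8 * a m j :=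
          Finset.sum_le_sum fun m _ => by have := hanchor m; linarith
      _ ≤ ∑ m ∈ range (N + 1), 8 * a m j :=
          Finset.sum_le_sum_of_subset_of_nonneg hsub2 fun m _ _ => by have := hann m j; positivity
      _ = 8 * ∑ m ∈ range (N + 1), a m j := by rw [Finset.mul_sum]
  have h2 : (if j = 0 then |∑ m ∈ Ioc n N, (Kp m).eval 0| else 0) ≤ ∑ m ∈ range (N + 1), a m j := by
    split_ifs with h0
    · subst h0
      calc |∑ m ∈ Ioc n N, (Kp m).eval 0| ≤ ∑ m ∈ Ioc n N, |(Kp m).eval 0| := Finset.abs_sum_le_sum_abs _ _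
        _ ≤ ∑ m ∈ Ioc n N, a m 0 := Finset.sum_le_sum fun m hm => by
            have h := ha m (Finset.mem_Ioc.mp hm).2 0 (by norm_num) (WithLp.toLp 2 0)
            rw [norm_iteratedFDeriv_zero, Real.norm_eq_abs] at h
            simpa [evalM] using h
        _ ≤ ∑ m ∈ range (N + 1), a m 0 := Finset.sum_le_sum_of_subset_of_nonneg hsub2 fun m _ _ => hann m 0
    · exact Finset.sum_nonneg fun m _ => hann m j
  unfold chainSizeSum
  linarith

/-- Frame sums of the piece sizes, orders `0, 1, 2`. -/
theorem sum_pieceSize_le_of_le_two {R : RenConsts} (hR : ∀ j, 0 ≤ R.Gfr j) (U : ℝ) (N : ℕ) {j : ℕ} (hj : j ≤ 2) :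
    ∑ m ∈ range (N + 1), pieceSize R U m j ≤ 2 * R.Gfr 0 * |U| + 2 * R.Gfr 1 * U ^ 2 + R.Gfr 2 * U ^ 2 * ((N : ℝ) + 1) := by
  have h0 := hR 0; have h1 := hR 1; have h2 := hR 2
  have hU2 : 0 ≤ U ^ 2 := sq_nonneg U
  have hUa : 0 ≤ |U| := abs_nonneg U
  have hN : (0 : ℝ) ≤ (N : ℝ) + 1 := by positivity
  unfold pieceSize
  interval_cases j
  · have hs : ∑ n ∈ range (N + 1), R.Gfr 0 * uPow 0 U * (4 : ℝ) ^ ((((0 : ℕ) : ℤ) - 2) * n) ≤ 2 * R.Gfr 0 * |U| := by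
      rw [← Finset.mul_sum]
      have := sum_four_zpow_le_two (j := 0) (by norm_num) N
      simp only [uPow, if_true] at *
      nlinarith [mul_nonneg h0 hUa]
    nlinarith [hs, mul_nonneg h1 hU2, mul_nonneg (mul_nonneg h2 hU2) hN]
  · have hs : ∑ n ∈ range (N + 1), R.Gfr 1 * uPow 1 U * (4 : ℝ) ^ ((((1 : ℕ) : ℤ) - 2) * n) ≤ 2 * R.Gfr 1 * U ^ 2 := by
      rw [← Finset.mul_sum]
      have := sum_four_zpow_le_two (j := 1) le_rfl N
      simp only [uPow, one_ne_zero, if_false] at *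
      nlinarith [mul_nonneg h1 hU2]
    nlinarith [hs, mul_nonneg h0 hUa, mul_nonneg (mul_nonneg h2 hU2) hN]
  · have hs : ∑ n ∈ range (N + 1), R.Gfr 2 * uPow 2 U * (4 : ℝ) ^ ((((2 : ℕ) : ℤ) - 2) * n) =
        R.Gfr 2 * U ^ 2 * ((N : ℝ) + 1) := by
      simp [uPow]; ring
    nlinarith [hs, mul_nonneg h0 hUa, mul_nonneg h1 hU2]

/-- Frame sum of the piece sizes, order `3`. -/
theorem sum_pieceSize_three_le {R : RenConsts} (hR : ∀ j, 0 ≤ R.Gfr j) (U : ℝ) (N : ℕ) :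
    ∑ m ∈ range (N + 1), pieceSize R U m 3 ≤ R.Gfr 3 * U ^ 2 * ((4 : ℝ) ^ (N + 1) / 3) := by
  unfold pieceSize
  rw [← Finset.mul_sum, show uPow 3 U = U ^ 2 from uPow_succ 2 U]
  exact mul_le_mul_of_nonneg_left (sum_four_zpow_order_three_le _) (mul_nonneg (hR 3) (sq_nonneg U))

/-- Frame sum of the piece sizes, order `4`. -/
theorem sum_pieceSize_four_le {R : RenConsts} (hR : ∀ j, 0 ≤ R.Gfr j) (U : ℝ) (N : ℕ) :
    ∑ m ∈ range (N + 1), pieceSize R U m 4 ≤ R.Gfr 4 * U ^ 2 * ((16 : ℝ) ^ (N + 1) / 15) := by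
  unfold pieceSize
  rw [← Finset.mul_sum, show uPow 4 U = U ^ 2 from uPow_succ 3 U]
  exact mul_le_mul_of_nonneg_left (sum_four_zpow_order_four_le _) (mul_nonneg (hR 4) (sq_nonneg U))

/-- **The chain thresholds do their job**: for `0 ≤ c ≤ klCurveC3 R/16`, `0 < U ≤ klCurveU0 R/16`, `4·msA R c U ≤ κ`. -/
theorem chain_thresholds {R : RenConsts} (hR : ∀ j, 0 ≤ R.Gfr j) {c U : ℝ} (hc : 0 ≤ c) (hcle : c ≤ klCurveC3 R / 16)
    (hU : 0 < U) (hUle : U ≤ klCurveU0 R / 16) : 4 * msA R c U ≤ klCurveKappa := by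
  have h := frame_thresholds_explicit hR (c := 16 * c) (U := 16 * U) (by positivity) (by linarith) (by positivity) (by linarith)
  have h1 := hR 1
  rw [abs_of_pos (by positivity : (0 : ℝ) < 16 * U)] at h
  have e1 : (16 * U) ^ 2 = 256 * U ^ 2 := by ring
  have e2 : R.Gfr 2 * (16 * c / Real.log 4) = 16 * (R.Gfr 2 * (c / Real.log 4)) := by ring
  rw [e1, e2] at h
  have h3 : 0 ≤ R.Gfr 1 * U ^ 2 := mul_nonneg h1 (sq_nonneg U)
  unfold msA; rw [abs_of_pos hU]
  nlinarith

/-- **THE CHAIN REGIME FROM THE PIECES**: in the KL regime with the chain thresholds, the seven regime hypotheses of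
`twoLegSizesMST_succ_of_chainF_table` hold with `A = msA R c U`, `A₃ = msA3 R U N`, `A₄ = msA4 R U N` (`N = nScales β`). -/
theorem chain_regime_of_pieces {R : RenConsts} (hR : ∀ j, 0 ≤ R.Gfr j) {c : ℝ} (hc : 0 < c) (hcle : c ≤ klCurveC3 R / 16)
    {U : ℝ} (hU : 0 < U) (hUle : U ≤ klCurveU0 R / 16) {β : ℝ} (hβmin : klBetaMin ≤ β) (hβc : β ≤ Real.exp (c / U ^ 2))
    {μ : ℝ} (hμ : μ ∈ klWindowC) {Kp : ℕ → TrigPolyC4v}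
    (ha : ∀ m ≤ nScales β, ∀ j ≤ 4, ∀ q : Momentum, ‖iteratedFDeriv ℝ j (evalM (Kp m)) q‖ ≤ pieceSize R U m j)
    {n : ℕ} (hn : n ≤ nScales β) :
    (∀ j ≤ 2, chainSizeSum Kp (pieceSize R U) n (nScales β) j ≤ msA R c U) ∧ msA R c U ≤ 1 / 20 ∧
    klCurveD ≤ (bandBounds (show (-4 : ℝ) < -1.1 by norm_num) (show (-1.1 : ℝ) ≤ -0.1 by norm_num)
      (show (-0.1 : ℝ) < 0 by norm_num)).Dtmin - 2 * msA R c U ∧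
    ((-1.1 : ℝ) ≤ μ - msA R c U ∧ μ + msA R c U ≤ -0.1) ∧
    chainSizeSum Kp (pieceSize R U) n (nScales β) 3 ≤ msA3 R U (nScales β) ∧
    chainSizeSum Kp (pieceSize R U) n (nScales β) 4 ≤ msA4 R U (nScales β) := by
  have hBD : (bandBounds (show (-4 : ℝ) < -1.1 by norm_num) (show (-1.1 : ℝ) ≤ -0.1 by norm_num)
      (show (-0.1 : ℝ) < 0 by norm_num)).Dtmin = cDtmin (-1.1) (-0.1) := rfl
  have hann := pieceSize_nonneg hR U
  have h4A := chain_thresholds hR hc.le hcle hU hUle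
  have hκ1 := klCurveKappa_le_cDtmin
  have hκ2 := klCurveKappa_le_fifth
  have hA20 : msA R c U ≤ 1 / 20 := by linarith
  have hreg := sq_mul_nScales_succ_le hc.le hβmin hβc
  have h2 := hR 2
  refine ⟨fun j hj => ?_, hA20, ?_, klWindowC_margin hμ hA20, ?_, ?_⟩
  · refine (chainSizeSum_le_sixteen_mul hn hann ha (by omega)).trans ?_
    have hs := sum_pieceSize_le_of_le_two hR U (nScales β) hj
    unfold msA
    nlinarith
  · rw [hBD]; unfold klCurveD; linarith
  · exact (chainSizeSum_le_sixteen_mul hn hann ha (by norm_num)).trans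
      (by unfold msA3; exact mul_le_mul_of_nonneg_left (sum_pieceSize_three_le hR U _) (by norm_num))
  · exact (chainSizeSum_le_sixteen_mul hn hann ha le_rfl).trans
      (by unfold msA4; exact mul_le_mul_of_nonneg_left (sum_pieceSize_four_le hR U _) (by norm_num))

/-! ## §2 (E3a-MS) at scale `n+1`, keyed by the pieces -/

section MS

variable {L M : ℕ} [NeZero L] [NeZero M] {G : GeoConsts} {Q : EngConsts} {R : RenConsts} {β U μ : ℝ}

/-- **(E3a-MS) AT SCALE `n+1` IN THE KL REGIME, KEYED BY THE ADMISSIBLE PIECES.**  See the module docstring. -/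
theorem twoLegSizesMST_succ_of_pieces (hR : ∀ j, 0 ≤ R.Gfr j) {c : ℝ} (hc : 0 < c) (hcle : c ≤ klCurveC3 R / 16)
    (hU : 0 < U) (hUle : U ≤ klCurveU0 R / 16) (hβmin : klBetaMin ≤ β) (hβc : β ≤ Real.exp (c / U ^ 2)) (hμ : μ ∈ klWindowC)
    {K : TrigPolyC4v} {Kp : ℕ → TrigPolyC4v} (hK : ∀ p : Fin 2 → ℝ, K.eval p = ∑ m ∈ range (nScales β + 1), (Kp m).eval p)
    (ha : ∀ m ≤ nScales β, ∀ j ≤ 4, ∀ q : Momentum, ‖iteratedFDeriv ℝ j (evalM (Kp m)) q‖ ≤ pieceSize R U m j)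
    {n : ℕ} (hn : n + 1 ≤ nScales β) (d : ℕ)
    (hc₁ : Continuous (klLocalPart L M β U μ K (n + 1))) (hc₀ : Continuous (klLocalPart L M β U μ K n))
    {S : ℕ → TrigPolyC4v}
    (hS : ∀ θ, klLocalPart L M β U μ K (n + 1) θ - klLocalPart L M β U μ K n θ =
      (S (nScales β - (n + 1))).eval (klFermiPoint μ K θ))
    {σ : ℕ → ℕ → ℝ} (hσnn : ∀ k l, 0 ≤ σ k l)
    (hσ0 : ∀ k ≤ nScales β - (n + 1), ∀ q : Momentum, |evalM (S k) q| ≤ σ k 0)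
    (hσ : ∀ k ≤ nScales β - (n + 1), ∀ l, 1 ≤ l → l ≤ 5 → ∀ q : Momentum, ‖iteratedFDeriv ℝ l (evalM (S k)) q‖ ≤ σ k l)
    {ε : ℕ → ℕ → ℝ} (hεnn : ∀ m l, 0 ≤ ε m l)
    (hε0 : ∀ m ∈ Ioc (n + 1) (nScales β), ∀ q : Momentum, |evalM (fsub (S (m - (n + 1))) (S (m - (n + 1) - 1))) q| ≤ ε m 0)
    (hε : ∀ m ∈ Ioc (n + 1) (nScales β), ∀ l, 1 ≤ l → l ≤ 4 → ∀ q : Momentum,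
      ‖iteratedFDeriv ℝ l (evalM (fsub (S (m - (n + 1))) (S (m - (n + 1) - 1)))) q‖ ≤ ε m l)
    {X : ℝ} (hX : ∀ l ≤ 4, ∀ x : ℝ, ‖iteratedFDeriv ℝ l salmhoferCutoff x‖ ≤ X)
    (hfit_n : ∀ j ≤ 4, (if j = 0 then σ 0 0 else 0) +
      (j.factorial : ℝ) ^ 2 * (2 * j.factorial * X * 200 ^ j) *
        bellCum (σ 0) (msD (msA3 R U (nScales β)) (msA4 R U (nScales β))) j *
        (4 + max 1 (((j - 1).factorial : ℝ) / (8 / 5))) ^ j ≤ twoLegBar G Q U j (n + 1))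
    (hfit_m : ∀ m ∈ Ioc (n + 1) (nScales β), ∀ j ≤ 4,
      (if j = 0 then ε m 0 + σ (m - (n + 1) - 1) 1 *
        msdD (msA R c U) (msA3 R U (nScales β)) (msA4 R U (nScales β)) ((bandBounds (show (-4 : ℝ) < -1.1 by norm_num)
          (show (-1.1 : ℝ) ≤ -0.1 by norm_num) (show (-0.1 : ℝ) < 0 by norm_num)).Dtmin) (msE d (pieceSize R U m)) 0 else 0) +
      (j.factorial : ℝ) ^ 2 * (2 * j.factorial * X * 200 ^ j) *
        (bellCum (ε m) (msD (msA3 R U (nScales β)) (msA4 R U (nScales β))) j +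
          bellDiffCum (σ (m - (n + 1) - 1)) (msD (msA3 R U (nScales β)) (msA4 R U (nScales β)))
            (msdD (msA R c U) (msA3 R U (nScales β)) (msA4 R U (nScales β)) ((bandBounds (show (-4 : ℝ) < -1.1 by norm_num)
              (show (-1.1 : ℝ) ≤ -0.1 by norm_num) (show (-0.1 : ℝ) < 0 by norm_num)).Dtmin) (msE d (pieceSize R U m))) j) *
        (4 + max 1 (((j - 1).factorial : ℝ) / (8 / 5))) ^ j ≤
        msBar G Q U (n + 1) * (R.Gfr j * uPow j U * (4 : ℝ) ^ (((j : ℤ) - 2) * m))) :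
    TwoLegSizesMST L M G Q R β U μ K (n + 1) := by
  obtain ⟨hA, hA20, hd, ⟨hlo, hhi⟩, hA₃, hA₄⟩ := chain_regime_of_pieces hR hc hcle hU hUle hβmin hβc hμ ha (n := n + 1) hn
  have he : ∀ m ∈ Ioc (n + 1) (nScales β), ∀ j ≤ 4, ∀ q : Momentum,
      ‖iteratedFDeriv ℝ j (evalM (highPart d (Kp m))) q‖ ≤ msE d (pieceSize R U m) j :=
    fun m hm j hj q => norm_iteratedFDeriv_evalM_highPart_le_msE d (ha m (Finset.mem_Ioc.mp hm).2) hj q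
  exact twoLegSizesMST_succ_of_chainF_table hμ hK hn d hc₁ hc₀ hS ha hA hA20 hd hlo hhi hA₃ hA₄ hσnn hσ0 hσ hεnn hε0 hε he hX
    hfit_n hfit_m

end MS

end Summit.HubbardSuperconductivity.HubbardSuperconductivity.Theorems.KLRegimeSplit

end
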